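import Summits.BirchSwinnertonDyer.BirchSwinnertonDyer.Theses.PrintX9
import Summits.BirchSwinnertonDyer.BirchSwinnertonDyer.Theorems.PrintX9HowardContainmentLightFrameOfPrintDepthPosLocalized
import Summits.BirchSwinnertonDyer.BirchSwinnertonDyer.Theorems.PrintX9HowardContainmentPinnedRung
import Summits.BirchSwinnertonDyer.BirchSwinnertonDyer.Theorems.PrintX9HowardContainmentLightFramePinnedOfPrintSharpStubEnvelope
import Literature.NumberTheory.EllipticCurves.IwasawaAlgebraPromotionProofs
import Literature.NumberTheory.EllipticCurves.HeegnerCharIdealEnvelopePowTransferProofs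
import Literature.NumberTheory.EllipticCurves.CastellaGrossiSkinner2025.HeegnerKolyvaginBoundAnyClassNumberProofs
import HarnessLib

/-!
# The deciding crux `PrintX9.HowardContainmentLightFramePinnedOfPrintSharp` MODULO ITS ONE RESIDUAL STUB
# `stub_muPartSharp` (line `torsion-depth-pinned`, skeleton v5.1; stmt-BirchSwinnertonDyer-27077) — CONDITIONAL CLOSER

Cell `pub/bsd-print-x9`, LEAD `bsd-line-x9-p1` (g0'). The registered skeleton on 27077 (evidence #3, sha16
5af12310b0d8f442) has three stubs: `stub_coprimeTied` (PROVED: `PrintX9Rung.stmt_coprimeTied`, p616846),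
`stub_envelopeModulesSharp` (LANDED BY NAME: `PrintX9SharpEnvelope.stub_envelopeModulesSharp`, p621799) and
`stub_muPartSharp` (OPEN — the μ-part at `p ∣ h_K`, BEYOND citable print, REF-118). This file puts the sorry-free part
of the skeleton INTO THE TREE: the residual statement `Stmt.muPartSharp` (abbrev, verbatim the registered letter), its
two honest currencies (`muPartSharp_of_muInequality`: the μ-INEQUALITY `μ(X_tors) ≤ 2μ(𝔖/ℋ_F)`;
`muPartSharp_of_muInvariant_eq_zero`: `μ(X_tors) = 0`), the localized package from the binders `hNV` (CGLS 4.1.1) and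
`hCGS` (CGS 6.5.2) with the landed envelope, and the CONDITIONAL closer
`howardContainmentLightFramePinnedOfPrintSharp_of_muPartSharp : Stmt.muPartSharp → HowardContainmentLightFramePinnedOfPrintSharp`
— the crux BY NAME from its one residual. Nothing is claimed about `Stmt.muPartSharp` itself (no `sorry`, no named fact);
whoever proves it closes 27077 in one line. «beyond-print theorem»: no. BSD is NOT proved by this file.
-/

set_option linter.dupNamespace false
set_option autoImplicit false

noncomputable section

open scoped Classical Pointwise
open Literature Literature.NumberTheory.EllipticCurves WeierstrassCurve
  Literature.NumberTheory.EllipticCurves.ModularForms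
open Summit.BirchSwinnertonDyer.BirchSwinnertonDyer.Theses.PrintX9

namespace Summit.BirchSwinnertonDyer.BirchSwinnertonDyer.Theorems.PrintX9SharpMuPart

/-! ## §1 The residual statement (registered stub letter, verbatim) -/

/-- **REGISTERED STUB STATEMENT `Stmt.muPartSharp`** of the skeleton v5.1 on stmt-BirchSwinnertonDyer-27077 (namespace
`…Cruxes.HowardContainmentLightFramePinnedOfPrintSharp.TorsionDepthPinned`), VERBATIM, re-homed under this Theorems-side
namespace: on every rank-one light X9 frame with `p ∣ h_K`, the `p`-localized TIED containment package (with `𝔖` f.g.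
and `𝔖/ℋ_F` torsion) promotes to the integral TIED containment. A statement abbreviation; NOT asserted, NOT a named
fact; no witness in the tree (this is the crux's residual). -/
abbrev Stmt.muPartSharp : Prop :=
    ∀ (W : WeierstrassCurve ℚ) [W.IsElliptic] [W.IsGloballyMinimal] (p : ℕ) [Fact p.Prime]
      [NeZero (W.conductorNorm ℤ)] (K : Type) [Field K] [NumberField K],
      Summit.BirchSwinnertonDyer.BirchSwinnertonDyer.Rank1Residual.ClassX9 W p →
      IsImaginaryQuadratic K → Odd (NumberField.discr K) → NumberField.discr K ≠ -3 →
      SatisfiesHeegnerHypothesis (W.conductorNorm ℤ) K → SatisfiesHeegnerHypothesis p K →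
      (W.baseChange K).HasIrreducibleModPGaloisRep p →
      ∀ (κ : ZpExtension K p), κ.IsAnticyclotomic → ∀ (γ : Field.absoluteGaloisGroup K),
      κ.IsTopGenerator γ →
      ∀ (Dt : ModularForms.ModularParametrizationData W (W.conductorNorm ℤ))
        (H : HeegnerDatum (W.conductorNorm ℤ) (NumberField.discr K)) (ιC : K →+* ℂ)
        (jbar : AlgebraicClosure K →+* ℂ),
      ¬ (p : ℤ) ∣ Dt.c → (W.baseChange K).mordellWeilRank = 1 →
      Finite (AddCommGroup.primaryComponent (W.baseChange K).sha p) →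
      p ∣ NumberField.classNumber K →
      (∃ (D : (W.baseChange K).LambdaAdicSelmerData κ γ)
          (F : HeegnerFamily (W.conductorNorm ℤ) W K κ jbar) (X : (W.baseChange K).SelmerDualData κ γ) (m : ℕ),
          F.Dt = Dt ∧ Module.Finite (IwasawaAlgebra p) X.X ∧ Module.Finite (IwasawaAlgebra p) D.S ∧
          Module.IsTorsion (IwasawaAlgebra p) (D.S ⧸ heegnerModule D F) ∧
          Ideal.span {((p : IwasawaAlgebra p) ^ m)} * heegnerCharIdeal D F ^ 2 ≤
            Module.charIdeal (IwasawaAlgebra p) (Submodule.torsion (IwasawaAlgebra p) X.X)) →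
      ∃ (D : (W.baseChange K).LambdaAdicSelmerData κ γ)
        (F : HeegnerFamily (W.conductorNorm ℤ) W K κ jbar) (X : (W.baseChange K).SelmerDualData κ γ),
        F.Dt = Dt ∧ heegnerCharIdeal D F ^ 2 ≤
          Module.charIdeal (IwasawaAlgebra p) (Submodule.torsion (IwasawaAlgebra p) X.X)

/-! ## §2 The residual in its two honest currencies -/

/-- **`Stmt.muPartSharp` ⟸ the μ-INEQUALITY `μ(X_tors) ≤ 2·μ(𝔖/ℋ_F)`** at every rank-one light X9 frame with
`p ∣ h_K` (x10b-p1's promotion `IwasawaAlgebra.sq_charIdeal_le_charIdeal_of_span_p_pow_mul_le_of_lengthAt_le_two_mul`,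
p613811). The sharp form of the residual: print gives `μ(I(ℋ_F)) = 0` (Hsieh / BCS25 Prop. 4.2.2 + the Λ-adic
reciprocity law), NOT this inequality at `p ∣ h_K` on X9 (Howard Thm. B / MZ26 Cor. 4.6 control `μ` only under
`p ∤ h_K`; CGS25 Thm. 6.5.2 / CGLS22 Thm. 4.1.3 are `Λ[1/p]` statements).
[cite: Washington1997, §13.2] [cite: CastellaGrossiSkinner2025, Thm. 6.5.2] [cite: MastellaZerman2026, Ass. 2.1, Cor. 4.6] -/
theorem muPartSharp_of_muInequality
    (hμ : ∀ (W : WeierstrassCurve ℚ) [W.IsElliptic] [W.IsGloballyMinimal] (p : ℕ) [Fact p.Prime]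
      [NeZero (W.conductorNorm ℤ)] (K : Type) [Field K] [NumberField K],
      Summit.BirchSwinnertonDyer.BirchSwinnertonDyer.Rank1Residual.ClassX9 W p →
      IsImaginaryQuadratic K → Odd (NumberField.discr K) → NumberField.discr K ≠ -3 →
      SatisfiesHeegnerHypothesis (W.conductorNorm ℤ) K → SatisfiesHeegnerHypothesis p K →
      (W.baseChange K).HasIrreducibleModPGaloisRep p →
      ∀ (κ : ZpExtension K p), κ.IsAnticyclotomic → ∀ (γ : Field.absoluteGaloisGroup K),
      κ.IsTopGenerator γ → ∀ (Dt : ModularForms.ModularParametrizationData W (W.conductorNorm ℤ))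
        (jbar : AlgebraicClosure K →+* ℂ),
      ¬ (p : ℤ) ∣ Dt.c → (W.baseChange K).mordellWeilRank = 1 →
      Finite (AddCommGroup.primaryComponent (W.baseChange K).sha p) →
      p ∣ NumberField.classNumber K →
      ∀ (D : (W.baseChange K).LambdaAdicSelmerData κ γ) (F : HeegnerFamily (W.conductorNorm ℤ) W K κ jbar)
        (X : (W.baseChange K).SelmerDualData κ γ), F.Dt = Dt →
        Module.Finite (IwasawaAlgebra p) X.X → Module.Finite (IwasawaAlgebra p) D.S →
        Module.IsTorsion (IwasawaAlgebra p) (D.S ⧸ heegnerModule D F) →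
      ∀ 𝔭 : PrimeSpectrum (IwasawaAlgebra p), 𝔭.asIdeal = Ideal.span {(p : IwasawaAlgebra p)} →
        Module.lengthAt (IwasawaAlgebra p) (Submodule.torsion (IwasawaAlgebra p) X.X) 𝔭 ≤
          2 * Module.lengthAt (IwasawaAlgebra p) (D.S ⧸ heegnerModule D F) 𝔭) :
    Stmt.muPartSharp := by
  intro W _ _ p _ _ K _ _ hX9 hK hodd h3 hHN hHp hirr κ hκ γ hγ Dt H ιC jbar hc hrk hfin hhK
    ⟨D, F, X, m, hFDt, hfinX, hfinS, htor, hloc⟩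
  haveI := hfinX
  haveI := hfinS
  haveI : IsNoetherian (IwasawaAlgebra p) X.X := isNoetherian_of_isNoetherianRing_of_finite _ _
  haveI : Module.Finite (IwasawaAlgebra p) (Submodule.torsion (IwasawaAlgebra p) X.X) := inferInstance
  refine ⟨D, F, X, hFDt, ?_⟩
  exact IwasawaAlgebra.sq_charIdeal_le_charIdeal_of_span_p_pow_mul_le_of_lengthAt_le_two_mul
    (Submodule.torsion_isTorsion (R := IwasawaAlgebra p) (M := X.X)) htor
    (hμ W p K hX9 hK hodd h3 hHN hHp hirr κ hκ γ hγ Dt jbar hc hrk hfin hhK D F X hFDt hfinX hfinS htor) hloc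

/-- **`Stmt.muPartSharp` ⟸ `μ(X_tors) = 0`** at every rank-one light X9 frame with `p ∣ h_K` (x10b-p1's promotion
`IwasawaAlgebra.le_charIdeal_of_span_p_pow_mul_le`, p607965) — the residual's other currency (given print's
`μ(I(ℋ_F)) = 0` the two coincide). [cite: Washington1997, §13.2] [cite: MastellaZerman2026, Ass. 2.1, Cor. 4.6] -/
theorem muPartSharp_of_muInvariant_eq_zero
    (hμ : ∀ (W : WeierstrassCurve ℚ) [W.IsElliptic] [W.IsGloballyMinimal] (p : ℕ) [Fact p.Prime]
      [NeZero (W.conductorNorm ℤ)] (K : Type) [Field K] [NumberField K],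
      Summit.BirchSwinnertonDyer.BirchSwinnertonDyer.Rank1Residual.ClassX9 W p →
      IsImaginaryQuadratic K → Odd (NumberField.discr K) → NumberField.discr K ≠ -3 →
      SatisfiesHeegnerHypothesis (W.conductorNorm ℤ) K → SatisfiesHeegnerHypothesis p K →
      (W.baseChange K).HasIrreducibleModPGaloisRep p →
      ∀ (κ : ZpExtension K p), κ.IsAnticyclotomic → ∀ (γ : Field.absoluteGaloisGroup K),
      κ.IsTopGenerator γ →
      (W.baseChange K).mordellWeilRank = 1 →
      Finite (AddCommGroup.primaryComponent (W.baseChange K).sha p) →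
      p ∣ NumberField.classNumber K →
      ∀ (X : (W.baseChange K).SelmerDualData κ γ), Module.Finite (IwasawaAlgebra p) X.X →
      ∀ 𝔭 : PrimeSpectrum (IwasawaAlgebra p), 𝔭.asIdeal = Ideal.span {(p : IwasawaAlgebra p)} →
        Module.lengthAt (IwasawaAlgebra p) (Submodule.torsion (IwasawaAlgebra p) X.X) 𝔭 = 0) :
    Stmt.muPartSharp := by
  intro W _ _ p _ _ K _ _ hX9 hK hodd h3 hHN hHp hirr κ hκ γ hγ Dt H ιC jbar hc hrk hfin hhK
    ⟨D, F, X, m, hFDt, hfinX, _, _, hloc⟩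
  haveI := hfinX
  haveI : IsNoetherian (IwasawaAlgebra p) X.X := isNoetherian_of_isNoetherianRing_of_finite _ _
  haveI : Module.Finite (IwasawaAlgebra p) (Submodule.torsion (IwasawaAlgebra p) X.X) := inferInstance
  refine ⟨D, F, X, hFDt, ?_⟩
  exact IwasawaAlgebra.le_charIdeal_of_span_p_pow_mul_le (Submodule.torsion_isTorsion (R := IwasawaAlgebra p) (M := X.X))
    (hμ W p K hX9 hK hodd h3 hHN hHp hirr κ hκ γ hγ hrk hfin hhK X hfinX) hloc

/-! ## §3 The localized package from `hNV`, `hCGS` and the landed envelope -/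

/-- Ideal bookkeeping: `(a) · ((b) · I)² = (a·b²) · I²`. [folklore] -/
private theorem span_singleton_mul_sq {R : Type*} [CommSemiring R] (a b : R) (I : Ideal R) :
    Ideal.span {a} * (Ideal.span {b} * I) ^ 2 = Ideal.span {a * b ^ 2} * I ^ 2 := by
  rw [mul_pow, Ideal.span_singleton_pow, ← mul_assoc, Ideal.span_singleton_mul_span_singleton]

/-- **The localized package for `Stmt.muPartSharp` from the MODULE-LEVEL envelope, CGLS Thm. 4.1.1 (torsion of `𝔖/Λκ_C`)
and CGS Thm. 6.5.2 (`p`-localized divisibility) BY NAME**: `𝔖` f.g., `X.X` f.g., `𝔖/ℋ_F` torsion and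
`(p^m) · I(ℋ_F)² ⊆ char_Λ(X_tors)` for some `m`. [cite: CastellaGrossiSkinner2025, Thm. 6.5.2]
[cite: CastellaGrossiLeeSkinner2022, Thm. 4.1.1, Rem. 4.1.4] -/
theorem package_of_envelopeModules
    {W : WeierstrassCurve ℚ} [W.IsGloballyMinimal] {p : ℕ} [Fact p.Prime] [NeZero (W.conductorNorm ℤ)]
    {K : Type} [Field K] [NumberField K] {κ : ZpExtension K p} {γ : Field.absoluteGaloisGroup K}
    {jbar : AlgebraicClosure K →+* ℂ}
    (h411 : CastellaGrossiLeeSkinner2022.thm411_torsionFree_heegnerClass_ne_bot_quotient_isTorsion.{0})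
    (h652 : CastellaGrossiSkinner2025.thm652_stabilized_rankOne_charIdeal_torsion_dvd_pLocalized.{0})
    (hyp : CastellaGrossiLeeSkinner2022.Thm413Hypotheses (W.conductorNorm ℤ) W K p κ γ)
    (D : (W.baseChange K).LambdaAdicSelmerData κ γ)
    (C : CastellaGrossiLeeSkinner2022.StabilizedHeegnerData (W.conductorNorm ℤ) W K κ jbar)
    (F : HeegnerFamily (W.conductorNorm ℤ) W K κ jbar) (X : (W.baseChange K).SelmerDualData κ γ)
    {e : ℕ} {g : IwasawaAlgebra p} (hg : g ≠ 0)
    (hfwd : ((p : IwasawaAlgebra p) ^ e) • heegnerModule D F ≤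
      CastellaGrossiLeeSkinner2022.stabilizedHeegnerModule D C)
    (hrev : g • CastellaGrossiLeeSkinner2022.stabilizedHeegnerModule D C ≤ heegnerModule D F) :
    Module.Finite (IwasawaAlgebra p) D.S ∧ Module.Finite (IwasawaAlgebra p) X.X ∧
      Module.IsTorsion (IwasawaAlgebra p) (D.S ⧸ heegnerModule D F) ∧
      ∃ m : ℕ, Ideal.span {((p : IwasawaAlgebra p) ^ m)} * heegnerCharIdeal D F ^ 2 ≤
        Module.charIdeal (IwasawaAlgebra p) (Submodule.torsion (IwasawaAlgebra p) X.X) := by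
  obtain ⟨⟨hSfin, -⟩, hXfin, -, -⟩ := h652 (W.conductorNorm ℤ) W K p κ γ jbar hyp D C X
  haveI := hSfin
  have htorC : Module.IsTorsion (IwasawaAlgebra p) (D.S ⧸ CastellaGrossiLeeSkinner2022.stabilizedHeegnerModule D C) :=
    CastellaGrossiLeeSkinner2022.isTorsion_quotient_stabilizedHeegnerModule_of_thm411 h411 hyp D C
  have htorF : Module.IsTorsion (IwasawaAlgebra p) (D.S ⧸ heegnerModule D F) :=
    isTorsion_quotient_heegnerModule_of_smul_stabilizedHeegnerModule_le D F C hg hrev htorC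
  obtain ⟨n, henv⟩ :=
    exists_span_pow_mul_heegnerCharIdeal_le_stabilizedHeegnerCharIdeal_of_pow_smul_le D F C e hfwd htorF
  obtain ⟨m, hm⟩ := CastellaGrossiSkinner2025.span_pow_mul_sq_le_charIdeal_torsion_of_thm652_stabilized h652
    hyp D C X
  refine ⟨hSfin, hXfin, htorF, m + n * 2, ?_⟩
  calc Ideal.span {((p : IwasawaAlgebra p) ^ (m + n * 2))} * heegnerCharIdeal D F ^ 2
      = Ideal.span {((p : IwasawaAlgebra p) ^ m)} *
          (Ideal.span {((p : IwasawaAlgebra p) ^ n)} * heegnerCharIdeal D F) ^ 2 := by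
        rw [span_singleton_mul_sq, ← pow_mul, ← pow_add]
    _ ≤ Ideal.span {((p : IwasawaAlgebra p) ^ m)} *
          CastellaGrossiLeeSkinner2022.stabilizedHeegnerCharIdeal D C ^ 2 :=
        Ideal.mul_mono_right (Ideal.pow_right_mono henv 2)
    _ ≤ _ := hm

/-! ## §4 The conditional closer -/

/-- **The deciding crux from its ONE residual**: `Stmt.muPartSharp → HowardContainmentLightFramePinnedOfPrintSharp`
(BY NAME on the route decl). `jbar := IsAlgClosed.lift` along `ιC`; `p ∤ h_K` ↦ `PrintX9Rung.stmt_coprimeTied hMZ`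
(MZ26 Cor. 4.6, PRINT); `p ∣ h_K` ↦ `D`, `X` exist, `(C, F, e, g)` ← the LANDED envelope
`PrintX9SharpEnvelope.stub_envelopeModulesSharp hTw`, the package from `hNV`/`hCGS` (`package_of_envelopeModules`,
hypotheses by `X9.thm413Hypotheses_of_lightFrame`) ⇒ `s_mu`. CONDITIONAL on the residual; credits nothing by itself.
[cite: MastellaZerman2026, Cor. 4.6] [cite: CastellaGrossiLeeSkinner2022, Thm. 4.1.1, Rem. 4.1.4] [cite: CastellaGrossiSkinner2025, Thm. 6.5.2] -/
theorem howardContainmentLightFramePinnedOfPrintSharp_of_muPartSharp (s_mu : Stmt.muPartSharp) :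
    Summit.BirchSwinnertonDyer.BirchSwinnertonDyer.Theses.PrintX9.HowardContainmentLightFramePinnedOfPrintSharp := by
  have s_cop := Summit.BirchSwinnertonDyer.BirchSwinnertonDyer.Theorems.PrintX9Rung.stmt_coprimeTied
  have s_env := Summit.BirchSwinnertonDyer.BirchSwinnertonDyer.Theorems.PrintX9SharpEnvelope.stub_envelopeModulesSharp
  intro hMZ hNV hCGS hTw W _ _ p _ _ K _ _ hX9 hK hodd h3 hHN hHp hirr κ hκ γ hγ Dt H ιC hc hrk hfin
  letI : Algebra K ℂ := ιC.toAlgebra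
  let jbar : AlgebraicClosure K →+* ℂ :=
    (IsAlgClosed.lift (R := K) (M := ℂ) (S := AlgebraicClosure K)).toRingHom
  by_cases hhK : p ∣ NumberField.classNumber K
  · obtain ⟨D⟩ := LambdaAdicSelmerDataExists.nonempty_lambdaAdicSelmerData (W.baseChange K) p κ hγ
    obtain ⟨X⟩ := (W.baseChange K).nonempty_selmerDualData_holds κ γ hγ
    obtain ⟨C, F, e, g, -, hFDt, hg, hfwd, hrev⟩ :=
      s_env hTw W p K hX9 hK hodd h3 hHN hHp hirr κ hκ γ hγ Dt H jbar D hc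
    have hX9' := Summit.BirchSwinnertonDyer.BirchSwinnertonDyer.Rank1Residual.classX9_census_of_classX9 W p hX9
    have hyp := Summit.BirchSwinnertonDyer.Rank1Residual.X9.thm413Hypotheses_of_lightFrame hX9' hK hodd h3 hHN
      hHp hκ hγ
    have h411 : CastellaGrossiLeeSkinner2022.thm411_torsionFree_heegnerClass_ne_bot_quotient_isTorsion.{0} := hNV
    have h652 : CastellaGrossiSkinner2025.thm652_stabilized_rankOne_charIdeal_torsion_dvd_pLocalized.{0} := hCGS
    obtain ⟨hfinS, hfinX, htorF, m, hloc⟩ := package_of_envelopeModules h411 h652 hyp D C F X hg hfwd hrev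
    obtain ⟨D', F', X', hF', hle⟩ := s_mu W p K hX9 hK hodd h3 hHN hHp hirr κ hκ γ hγ Dt H ιC jbar hc hrk
      hfin hhK ⟨D, F, X, m, hFDt, hfinX, hfinS, htorF, hloc⟩
    exact ⟨jbar, D', F', X', hF', hle⟩
  · obtain ⟨D, F, X, hF, hle⟩ := s_cop hMZ W p K hX9 hK hodd h3 hHN hHp hirr κ hκ γ hγ Dt H ιC jbar hc hrk hfin hhK
    exact ⟨jbar, D, F, X, hF, hle⟩

end Summit.BirchSwinnertonDyer.BirchSwinnertonDyer.Theorems.PrintX9SharpMuPart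

end
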